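import Summits.Ventures.LatticeQCDFlow.Scaling.SimulatedTemperingPerfectWithinLevel
import Summits.Ventures.LatticeQCDFlow.Scaling.SwapLadderDeliveryTime

/-!
HONEST FRAMING: exact (Metropolis-corrected) sampling algorithms for lattice gauge theory; figures
of merit are autocorrelation/cost numbers at stated couplings and volumes; no continuum-physics
claim.

# SimulatedTemperingLevelWalk — UNDER PERFECT WITHIN-LEVEL SAMPLING THE COUPLING INDEX OF THE SIMULATED-TEMPERING
# SAMPLER IS EXACTLY A BIRTH–DEATH CHAIN WITH RATES HALF THE ADJACENT OVERLAPS; ON A LADDER TUNED TO UNIFORM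
# OVERLAP `a` IT IS ROW 22's IDEALISED `ladderWalk K a`, WHOSE END-TO-END DELIVERY TIME IS `K(K+1)/a`
# (lean-2 GEN-14, ours; the bridge between the cell's two ladder formalisms)

Venture-side (OURS).  Cell `lqcd-flow` (pub-lqcd), unit `pub-lqcd-lean-2-g14`, 2026-08-24.  Row 22
(`Scaling/SwapLadderDeliveryTime`) analysed the IDEALISED label walk of a tempering ladder — the birth–death
chain `ladderWalk K a` moving up / down with probability `a/2` — and proved its delivery time `E_0(τ_K) = K(K+1)/a`
from the Literature's Levin–Peres–Wilmer §2.5, flagging as NOT CLAIMED "that the label dynamics IS this walk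
(successive decisions are correlated through the configurations)".  This file proves WHEN it is: for the
simulated-tempering sampler of GEN-14 with PERFECT within-level sampling (`Scaling/SimulatedTemperingPerfectWithinLevel`:
redraw the configuration from `μ_{β_k}`, then make the exact-weight Metropolis level move — `L ∘ₖ W_perfect`),
the one-step law of the level is a function of the current level alone (Dynkin lumpability) and equals the
birth–death matrix `bdKernel K p q` with `p_k = ½·ov_k` (`k < K`), `q_k = ½·ov_{k−1}` (`k ≥ 1`),
`ov_j = ∫ min(p_{β_j}, p_{β_{j+1}}) dμ` the adjacent overlap (GEN-11) — and on a ladder with uniform adjacent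
overlap `a` it IS `ladderWalk K a`.  With imperfect within-level sampling the level process is not Markov, but
GEN-14's exact lag-one law (`Scaling/SimulatedTemperingExactLevelLaw`) is the same for every within-level kernel.

## What is defined / proved (`μ` probability, `X` bounded measurable)

* `stOverlap X μ β j`, `stLadderUp`, `stLadderDown`, **`stLevelWalk X μ β K = bdKernel K stLadderUp stLadderDown`**.
* `integral_stUpProb`, `integral_stDownProb` (`∫ u(k,·) dμ_{β_k} = p_k`, `∫ d(k,·) dμ_{β_k} = q_k`);
  `stLevelKernel_real_self` (`L(z){lev = lev z} = 1 − u − d`), `stLevelKernel_real_far` (`= 0` two or more rungs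
  away); `stPerfect_comp_real` (`(L ∘ₖ W_perfect)(k,x)(S) = ∫ L(k,x')(S) dμ_{β_k}(x')`).
* **`stPerfect_levelKernel_eq_walk`** — `((L ∘ₖ W_perfect)(k, x)).real {level = k'} = stLevelWalk X μ β K k k'`
  for all `k, k'`, `x` (independent of `x`).
* **`stLevelWalk_eq_ladderWalk`** — uniform adjacent overlaps `ov_j = a` (`j < K`) ⇒ `stLevelWalk = ladderWalk K a`;
  **`stPerfect_delivery_time`** — then (row 22) the level walk has a hitting-time solution with
  `E_0(τ_K) = K(K+1)/a` (`0 < a ≤ 1`).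

NOT CLAIMED: the trajectory-level statement (that hitting times of the sampler's level process are those of
the lumped chain — standard from lumpability, not typed: the tree's hitting-time theory is matrix-side);
non-perfect within-level sampling (then the level process is not Markov); anything measured.  Literature grade
(cell rule): KNOWN MECHANISM (lumpability; the diffusion-in-replica-space picture, Katzgraber–Trebst–Huse–Troyer
2006), NEW TYPING (kernel-exact identification of row 22's idealisation); nothing cited as a fact.
-/

noncomputable section

open MeasureTheory ProbabilityTheory Set Filter Finset
open Summit.Ventures.LatticeQCDFlow.Scoring
open Literature.Probability.MarkovChains
open scoped ENNReal

namespace Summit.Ventures.LatticeQCDFlow.Scaling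

section Walk

variable {Ω : Type*} [MeasurableSpace Ω]

/-- The adjacent overlap `ov_j = ∫ min(p_{β_j}, p_{β_{j+1}}) dμ`. [ours] -/
def stOverlap (X : Ω → ℝ) (μ : Measure Ω) (β : ℕ → ℝ) (j : ℕ) : ℝ :=
  ∫ x, min (Real.exp (β j * X x) / mgf X μ (β j)) (Real.exp (β (j + 1) * X x) / mgf X μ (β (j + 1))) ∂μ

/-- Up-rates of the lumped level walk: `½·ov_k` below the top rung, `0` at the top. [ours] -/
def stLadderUp (X : Ω → ℝ) (μ : Measure Ω) (β : ℕ → ℝ) (K : ℕ) (k : ℕ) : ℝ :=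
  if k < K then stOverlap X μ β k / 2 else 0

/-- Down-rates: `½·ov_{k−1}` above the bottom rung, `0` at the bottom. [ours] -/
def stLadderDown (X : Ω → ℝ) (μ : Measure Ω) (β : ℕ → ℝ) (k : ℕ) : ℝ :=
  if k = 0 then 0 else stOverlap X μ β (k - 1) / 2

/-- **The lumped level walk**: the birth–death matrix with rates `stLadderUp`, `stLadderDown` (the Literature's
`bdKernel`, as in row 22's `ladderWalk`). [ours] -/
def stLevelWalk (X : Ω → ℝ) (μ : Measure Ω) (β : ℕ → ℝ) (K : ℕ) : Matrix (Fin (K + 1)) (Fin (K + 1)) ℝ :=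
  bdKernel K (stLadderUp X μ β K) (stLadderDown X μ β)

variable {X : Ω → ℝ} {μ : Measure Ω} [IsProbabilityMeasure μ] {β : ℕ → ℝ} {K : ℕ}

/-- `∫ u(k, ·) dμ_{β_k} = p_k`. [ours] -/
theorem integral_stUpProb (hXm : Measurable X) (hXb : ∃ C, ∀ x, |X x| ≤ C) (k : Fin (K + 1)) :
    ∫ x, stUpProb X μ β K (k, x) ∂(μ.tilted fun x => β k * X x) = stLadderUp X μ β K k := by
  haveI := isProbabilityMeasure_tilted_mul (μ := μ) hXm hXb (β k)
  unfold stUpProb stLadderUp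
  dsimp only
  split_ifs with hk
  · rw [integral_const_mul, stOverlap, stAcc_eq_overlap hXm hXb (β k) (β (k + 1))]; ring
  · simp

/-- `∫ d(k, ·) dμ_{β_k} = q_k`. [ours] -/
theorem integral_stDownProb (hXm : Measurable X) (hXb : ∃ C, ∀ x, |X x| ≤ C) (k : Fin (K + 1)) :
    ∫ x, stDownProb X μ β K (k, x) ∂(μ.tilted fun x => β k * X x) = stLadderDown X μ β k := by
  haveI := isProbabilityMeasure_tilted_mul (μ := μ) hXm hXb (β k)
  unfold stDownProb stLadderDown
  dsimp only
  by_cases hk : 1 ≤ ((k : Fin (K + 1)) : ℕ)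
  · have hk0 : ¬ ((k : Fin (K + 1)) : ℕ) = 0 := by omega
    simp only [hk, if_true, hk0, if_false]
    rw [integral_const_mul, stOverlap, stAcc_eq_overlap hXm hXb (β k) (β ((k : ℕ) - 1))]
    simp only [Nat.sub_add_cancel hk]
    rw [integral_congr_ae (ae_of_all _ fun x => min_comm _ _)]
    ring
  · have hk0 : ((k : Fin (K + 1)) : ℕ) = 0 := by omega
    simp [hk0]

omit [IsProbabilityMeasure μ] in
/-- `L(z){level = level z} = 1 − u(z) − d(z)` (complement of GEN-14's `stLevelKernel_real_moves_eq`). [ours] -/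
theorem stLevelKernel_real_self (hXm : Measurable X) (z : Fin (K + 1) × Ω) :
    (stLevelKernel hXm μ β K z).real {y | ((y.1 : Fin (K + 1)) : ℕ) = ((z.1 : Fin (K + 1)) : ℕ)} =
      1 - (stUpProb X μ β K z + stDownProb X μ β K z) := by
  have hS : MeasurableSet {y : Fin (K + 1) × Ω | ((y.1 : Fin (K + 1)) : ℕ) ≠ ((z.1 : Fin (K + 1)) : ℕ)} := by
    have e : {y : Fin (K + 1) × Ω | ((y.1 : Fin (K + 1)) : ℕ) ≠ ((z.1 : Fin (K + 1)) : ℕ)} =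
        (fun y : Fin (K + 1) × Ω => ((y.1 : Fin (K + 1)) : ℕ)) ⁻¹' {n : ℕ | n ≠ ((z.1 : Fin (K + 1)) : ℕ)} := by
      ext y; simp
    rw [e]; exact measurable_stLevel MeasurableSet.of_discrete
  have e : {y : Fin (K + 1) × Ω | ((y.1 : Fin (K + 1)) : ℕ) = ((z.1 : Fin (K + 1)) : ℕ)} =
      {y : Fin (K + 1) × Ω | ((y.1 : Fin (K + 1)) : ℕ) ≠ ((z.1 : Fin (K + 1)) : ℕ)}ᶜ := by
    ext y; simp
  rw [e, measureReal_compl hS, probReal_univ, stLevelKernel_real_moves_eq hXm z]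

omit [IsProbabilityMeasure μ] in
/-- `L(k, x){level = k'} = 0` when `k'` is two or more rungs away from `k`. [ours] -/
theorem stLevelKernel_real_far (hXm : Measurable X) (k k' : Fin (K + 1)) (x : Ω) (h1 : (k' : ℕ) ≠ k + 1)
    (h2 : (k : ℕ) ≠ k' + 1) (h3 : k ≠ k') :
    (stLevelKernel hXm μ β K (k, x)).real {y | ((y.1 : Fin (K + 1)) : ℕ) = (k' : ℕ)} = 0 := by
  have hkk : (k : ℕ) ≠ k' := fun h => h3 (Fin.ext h)
  have hsub : {y : Fin (K + 1) × Ω | ((y.1 : Fin (K + 1)) : ℕ) = (k' : ℕ)} ⊆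
      {y | ¬ |(((y.1 : Fin (K + 1)) : ℕ) : ℝ) - (((k, x) : Fin (K + 1) × Ω).1 : ℕ)| ≤ 1} := by
    intro y hy
    simp only [Set.mem_setOf_eq] at hy ⊢
    rw [hy, abs_le]
    rintro ⟨ha, hb⟩
    have ha' : ((k : ℕ) : ℝ) ≤ (k' : ℕ) + 1 := by linarith
    have hb' : ((k' : ℕ) : ℝ) ≤ (k : ℕ) + 1 := by linarith
    have ha'' : (k : ℕ) ≤ (k' : ℕ) + 1 := by exact_mod_cast ha'
    have hb'' : (k' : ℕ) ≤ (k : ℕ) + 1 := by exact_mod_cast hb'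
    omega
  rw [measureReal_def, measure_mono_null hsub (ae_iff.1 (stLevelKernel_nearestNeighbour hXm (μ := μ) (β := β) (k, x))),
    ENNReal.toReal_zero]

omit [IsProbabilityMeasure μ] in
/-- `(L ∘ₖ W_perfect)(k, x)(S) = ∫ L(k, x')(S) dμ_{β_k}(x')` — the perfect sweep redraws `x'` from `μ_{β_k}`,
then the level move acts. [ours] -/
theorem stPerfect_comp_real (hXm : Measurable X) (k : Fin (K + 1)) (x : Ω)
    {S : Set (Fin (K + 1) × Ω)} (hS : MeasurableSet S) :
    ((stLevelKernel hXm μ β K ∘ₖ stPerfectWithinLevel X μ β K) (k, x)).real S =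
      ∫ x', (stLevelKernel hXm μ β K (k, x')).real S ∂(μ.tilted fun x => β k * X x) := by
  rw [measureReal_def, Kernel.comp_apply' _ _ _ hS]
  unfold stPerfectWithinLevel
  rw [lintegral_stWithinLevel _ ((stLevelKernel hXm μ β K).measurable_coe hS), Kernel.const_apply]
  dsimp only
  simp only [measureReal_def]
  have hf : Measurable fun x' : Ω => stLevelKernel hXm μ β K (k, x') S :=
    ((stLevelKernel hXm μ β K).measurable_coe hS).comp measurable_prodMk_left
  rw [integral_toReal hf.aemeasurable (ae_of_all _ fun x' => measure_lt_top _ _)]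

/-- **THE LEVEL OF THE PERFECTLY-SWEPT SAMPLER IS THE LUMPED BIRTH–DEATH WALK**: for all `k, k'` and every
configuration `x`, `((L ∘ₖ W_perfect)(k, x)).real {level = k'} = stLevelWalk X μ β K k k'`. [ours] -/
theorem stPerfect_levelKernel_eq_walk (hXm : Measurable X) (hXb : ∃ C, ∀ x, |X x| ≤ C) (k k' : Fin (K + 1))
    (x : Ω) :
    ((stLevelKernel hXm μ β K ∘ₖ stPerfectWithinLevel X μ β K) (k, x)).real
        {y | ((y.1 : Fin (K + 1)) : ℕ) = (k' : ℕ)} = stLevelWalk X μ β K k k' := by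
  haveI := isProbabilityMeasure_tilted_mul (μ := μ) hXm hXb (β k)
  have hS : MeasurableSet {y : Fin (K + 1) × Ω | ((y.1 : Fin (K + 1)) : ℕ) = (k' : ℕ)} :=
    measurable_stLevel (measurableSet_singleton _)
  rw [stPerfect_comp_real hXm k x hS]
  unfold stLevelWalk
  by_cases h1 : (k' : ℕ) = k + 1
  · -- one rung up
    have hk : (k : ℕ) < K := by have := k'.isLt; omega
    simp only [h1, stLevelKernel_real_up hXm k _ hk]
    rw [integral_stUpProb hXm hXb, bdKernel_apply_succ h1]
  by_cases h2 : (k : ℕ) = k' + 1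
  · -- one rung down
    have hk : 1 ≤ (k : ℕ) := by omega
    have e : ∀ x', (stLevelKernel hXm μ β K (k, x')).real {y | ((y.1 : Fin (K + 1)) : ℕ) = (k' : ℕ)} =
        (stLevelKernel hXm μ β K (k, x')).real {y | ((y.1 : Fin (K + 1)) : ℕ) + 1 = (k : ℕ)} := by
      intro x'
      have hset : {y : Fin (K + 1) × Ω | ((y.1 : Fin (K + 1)) : ℕ) = (k' : ℕ)} =
          {y | ((y.1 : Fin (K + 1)) : ℕ) + 1 = (k : ℕ)} := by
        ext y; simp only [Set.mem_setOf_eq]; omega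
      rw [hset]
    simp only [e, stLevelKernel_real_down hXm k _ hk]
    rw [integral_stDownProb hXm hXb, bdKernel_apply_pred h2]
  by_cases h3 : k = k'
  · -- stay
    subst h3
    simp only [stLevelKernel_real_self hXm]
    have iu : Integrable (fun x' => stUpProb X μ β K (k, x')) (μ.tilted fun x => β k * X x) :=
      Integrable.of_bound ((measurable_stUpProb hXm).comp measurable_prodMk_left).aestronglyMeasurable (1 / 2)
        (ae_of_all _ fun x' => by
          rw [Real.norm_eq_abs, abs_of_nonneg (stUpProb_nonneg _)]; exact stUpProb_le_half _)
    have id' : Integrable (fun x' => stDownProb X μ β K (k, x')) (μ.tilted fun x => β k * X x) :=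
      Integrable.of_bound ((measurable_stDownProb hXm).comp measurable_prodMk_left).aestronglyMeasurable (1 / 2)
        (ae_of_all _ fun x' => by
          rw [Real.norm_eq_abs, abs_of_nonneg (stDownProb_nonneg _)]; exact stDownProb_le_half _)
    have iud : Integrable (fun x' => stUpProb X μ β K (k, x') + stDownProb X μ β K (k, x'))
        (μ.tilted fun x => β k * X x) := iu.add id'
    rw [integral_sub (integrable_const 1) iud, integral_add iu id', integral_const, probReal_univ,
      one_smul, integral_stUpProb hXm hXb, integral_stDownProb hXm hXb, bdKernel_apply_self]
    ring
  · -- two or more rungs away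
    simp only [stLevelKernel_real_far hXm k k' _ h1 h2 h3, integral_zero]
    rw [bdKernel_apply_of_ne h1 h2 h3]

omit [IsProbabilityMeasure μ] in
/-- **ON A LADDER WITH UNIFORM ADJACENT OVERLAP `a` THE LUMPED WALK IS ROW 22's `ladderWalk K a`.** [ours] -/
theorem stLevelWalk_eq_ladderWalk {a : ℝ} (h : ∀ j, j < K → stOverlap X μ β j = a) :
    stLevelWalk X μ β K = ladderWalk K a := by
  unfold stLevelWalk ladderWalk
  have hu : stLadderUp X μ β K = ladderUp K a := by
    funext j; unfold stLadderUp ladderUp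
    split_ifs with hj
    · rw [h j hj]
    · rfl
  have hd : ∀ j, j ≤ K → stLadderDown X μ β j = ladderDown a j := by
    intro j hj; unfold stLadderDown ladderDown
    split_ifs with hj0
    · rfl
    · rw [h (j - 1) (by omega)]
  rw [hu]
  -- the down-rates agree on `0..K`, which is all `bdKernel` reads
  ext i j
  simp only [bdKernel, Matrix.of_apply, hd i i.is_le]

omit [IsProbabilityMeasure μ] in
/-- **DELIVERY TIME, EXACTLY** (row 22's `ladder_delivery_time'` for the lumped walk): under perfect within-level
sampling on a ladder with uniform adjacent overlap `0 < a ≤ 1`, the level walk of the simulated-tempering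
sampler has a hitting-time solution with `E_0(τ_K) = K(K+1)/a` — a configuration born at the bottom coupling
reaches the top after `K(K+1)/a` steps in expectation. [ours] -/
theorem stPerfect_delivery_time {a : ℝ} (ha0 : 0 < a) (ha1 : a ≤ 1) (h : ∀ j, j < K → stOverlap X μ β j = a) :
    ∃ hit : Fin (K + 1) → Fin (K + 1) → ℝ, IsHittingTimeSolution (stLevelWalk X μ β K) hit ∧
      hit 0 (Fin.last K) = (K : ℝ) * (K + 1) / a := by
  rw [stLevelWalk_eq_ladderWalk h]
  exact ladder_delivery_time' K ha0 ha1

end Walk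

end Summit.Ventures.LatticeQCDFlow.Scaling

end
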